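import Summits.HodgeConjecture.CorCM.Census.CyclicCharacterEquator
import Summits.HodgeConjecture.CorCM.Census.CyclicCharacterQuarticMeta
import Summits.HodgeConjecture.CorCM.Census.CyclicCharacterArcShift
import Summits.HodgeConjecture.CorCM.Census.CyclicCharacterFibreLaw
import Summits.HodgeConjecture.CorCM.Census.BaseBlockCoveringOn

/-!
# Cyclic characters, XIX: THE ℤ/4-SYLOW LAW — `μ(G, c) = β(G, c) − 1` for every finite group with `G / ker w ≅ ℤ/4` and odd kernel

COR-CM (cell `pub-hodgecm2`), count-neutral kernel combinatorics by the binder seat b09 (gen 42; lane CYCLIC-CHARACTER FIBRE LAW, part XIX), on parts XVI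
(`Census/CyclicCharacterArcShift.lean`: the exact arc-shift META), XVII (`Census/CyclicCharacterNearLinearisation.lean`: relations from any cover), XVIII
(`Census/CyclicCharacterQuarticLawPrep.lean`), gen 38ʼs covering on a set of blocks (`Census/BaseBlockCoveringOn.lean`) and gen 41ʼs fibre law
(`Census/CyclicCharacterFibreLaw.lean`) BY NAME.  Theorems only (no definition, no `decide`, no certificate, no named fact, no `sorry`).
HONEST FRAMING: `HC_CM` is NOT proved, here or anywhere in the tree; nothing here is a period or a headline.

**THE LAW (`isLeast_card_gfaces_generate_of_two`, `…_card_block`).**  Let `G` be a finite group, `c` a central involution, `w : G ↠ ℤ/4` additive with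
`w c ≠ 0`, whose kernel consists of elements of odd order and is not trivial — equivalently (Burnside) `|G| = 4·odd > 4` with CYCLIC Sylow `2`-subgroup and
central involution: the dicyclic groups `Dic_m`, `ℤ/4m`, `ℤ/4 × B` and `N ⋊ ℤ/4` for EVERY odd-order `N` (abelian or not) and every involutive
automorphism.  Then the least number of rank-four face relations whose base changes generate, with the pairs, the integer Hodge lattice is
**`μ(G, c) = φ₂(G, c) = β(G, c) − 1`**, `β` the number of blocks (simple CM isogeny classes split by the field).

PROOF (uniform, no case analysis, no parity or coboundary computation).  With `n = |ker w| = 2m + 1`: take gen 38ʼs cover of the arc block (`β − 3` faces: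
the near zone has the three blocks of part XVIII), and the TWO EQUATOR FACES of the bottom walk `T_0 → T_1`: `f₃ = gface X_{B'} t t'` (`|B'| = m`, three
corners on `T_1`ʼs side) and `f₁ = gface X_{B'∖b} b t` (one corner on `T_1`ʼs side).  Part XVII turns them into the near-zone relations
`R(B')` and `R(B' ∪ t)` where `R(X) = [T_0] − [T_1] + Σ_{s ∈ X} ε_s − Σ_{s ∈ F_0∖X} η_s` (`ε` bottom flips of `T_0`, `η` top flips of `T_1`); their
difference is `ζ_t = ε_t + η_t`, whose `ker w`-translates give every `ζ_s`; then `(W2) = R(B') + Σ_{s ∉ B'} ζ_s` and the arc-shift vector of a top point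
`u` is `−ζ_t·Q` modulo pairs (`w Q = −1`).  Part XVIʼs exact META (`|S₀| ≤ β − 1 = φ₂`) finishes.  Numerically (gen 42 `py/eqsearch.py`) these are
exactly the closing pairs that work in `Dic₅` and `ℤ/20` (all 900 pairs of types (one-across, three-across), and no other pair).

## References
* [Pohlmann1968] H. Pohlmann, Algebraic cycles on abelian varieties of complex multiplication type, Ann. of Math. 88 (1968), Thm 1.
* [Milne1999] J. S. Milne, Lefschetz motives and the Tate conjecture, Compositio Math. 117 (1999), Prop. 2.1, p. 54.
-/

namespace Summit.HodgeConjecture.CorCM.Census.CyclicCharacter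

open Finset
open Summit.HodgeConjecture.CorCM.Prior.AllgGroup.RfwfAllgGroup
open Summit.HodgeConjecture.CorCM.Census.BlockParity
open Summit.HodgeConjecture.CorCM.Census.Coinvariant
open Summit.HodgeConjecture.CorCM.Census.TwistGeneration
open Summit.HodgeConjecture.CorCM.Census.Nondegenerate
open Summit.HodgeConjecture.CorCM.Census.BaseBlock
open Summit.HodgeConjecture.CorCM.Census.Splitting

noncomputable section

variable {G : Type*} [Group G] [Fintype G] [DecidableEq G] {k : ℕ} {w : G → ZMod (2 ^ k)} {c : G}

/-! ## §3 Near-zone algebra: `ζ`, the fibre sum, the top arc shift -/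

/-- **`ζ_t = ε_t + η_t ∈ L`** from the two equator relations `R(B')`, `R(B' ∪ t)`. [folklore] -/
theorem zeta_mem_of_rels (hw : ∀ P Q : G, w (P * Q) = w P + w Q) (hk : 1 ≤ k) (hc2 : c * c = 1) (hwc : w c ≠ 0)
    (L : Submodule ℤ (CMF G c →₀ ℤ)) {B' : Finset G} {t : G} (ht : t ∈ (univ.filter fun s : G => w s = 0) \ B')
    (h3 : Finsupp.single (arcType hw hk hc2 hwc 0) (1 : ℤ) - Finsupp.single (arcType hw hk hc2 hwc 1) 1 + (∑ s ∈ B', (Finsupp.single (oflipCM c hc2 s (arcType hw hk hc2 hwc 0)) (1 : ℤ) - Finsupp.single (arcType hw hk hc2 hwc 0) 1)) - (∑ s ∈ (univ.filter fun s : G => w s = 0) \ B', (Finsupp.single (oflipCM c hc2 s (arcType hw hk hc2 hwc 1)) (1 : ℤ) - Finsupp.single (arcType hw hk hc2 hwc 1) 1)) ∈ L)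
    (h1 : Finsupp.single (arcType hw hk hc2 hwc 0) (1 : ℤ) - Finsupp.single (arcType hw hk hc2 hwc 1) 1 + (∑ s ∈ B', (Finsupp.single (oflipCM c hc2 s (arcType hw hk hc2 hwc 0)) (1 : ℤ) - Finsupp.single (arcType hw hk hc2 hwc 0) 1)) + (Finsupp.single (oflipCM c hc2 t (arcType hw hk hc2 hwc 0)) (1 : ℤ) - Finsupp.single (arcType hw hk hc2 hwc 0) 1) -
      (∑ s ∈ ((univ.filter fun s : G => w s = 0) \ B').erase t, (Finsupp.single (oflipCM c hc2 s (arcType hw hk hc2 hwc 1)) (1 : ℤ) - Finsupp.single (arcType hw hk hc2 hwc 1) 1)) ∈ L) :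
    (Finsupp.single (oflipCM c hc2 t (arcType hw hk hc2 hwc 0)) (1 : ℤ) - Finsupp.single (arcType hw hk hc2 hwc 0) 1) + (Finsupp.single (oflipCM c hc2 t (arcType hw hk hc2 hwc 1)) (1 : ℤ) - Finsupp.single (arcType hw hk hc2 hwc 1) 1) ∈ L := by
  have h := Submodule.sub_mem _ h1 h3
  rw [← add_sum_erase _ _ ht] at h
  convert h using 1
  abel

/-- **Translating `ζ` along the kernel**: `ζ_t ∈ ℤ⟨pairs⟩ + ℤ[G]·S ⟹ ζ_s ∈ ℤ⟨pairs⟩ + ℤ[G]·S` for `w s = w t = 0` (central `c`). [folklore] -/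
theorem zeta_mem_of_zeta_mem (hw : ∀ P Q : G, w (P * Q) = w P + w Q) (hk : 1 ≤ k) (hc2 : c * c = 1) (hcen : ∀ x : G, x * c = c * x)
    (hwc : w c ≠ 0) (S : Finset (CMF G c →₀ ℤ)) {t s : G} (ht : w t = 0) (hs : w s = 0)
    (h : (Finsupp.single (oflipCM c hc2 t (arcType hw hk hc2 hwc 0)) (1 : ℤ) - Finsupp.single (arcType hw hk hc2 hwc 0) 1) + (Finsupp.single (oflipCM c hc2 t (arcType hw hk hc2 hwc 1)) (1 : ℤ) - Finsupp.single (arcType hw hk hc2 hwc 1) 1) ∈ Submodule.span ℤ (pairSet c) ⊔ Submodule.span ℤ (translates c S)) :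
    (Finsupp.single (oflipCM c hc2 s (arcType hw hk hc2 hwc 0)) (1 : ℤ) - Finsupp.single (arcType hw hk hc2 hwc 0) 1) + (Finsupp.single (oflipCM c hc2 s (arcType hw hk hc2 hwc 1)) (1 : ℤ) - Finsupp.single (arcType hw hk hc2 hwc 1) 1) ∈ Submodule.span ℤ (pairSet c) ⊔ Submodule.span ℤ (translates c S) := by
  have hQ : w (s⁻¹ * t) = 0 := by rw [hw, map_inv hw, hs, ht, neg_zero, add_zero]
  have e : s = t * (s⁻¹ * t)⁻¹ := by rw [mul_inv_rev, inv_inv, mul_inv_cancel_left]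
  have h' := mapDomain_rt_mem_psp c hcen (s⁻¹ * t) S h
  simp only [Finsupp.mapDomain_add, Finsupp.mapDomain_sub, Finsupp.mapDomain_single, rt_oflipCM, rt_arcType, hQ, sub_zero] at h'
  rw [e]; exact h'

/-- **The fibre-sum relation from `R(B')` and the `ζ_s`, `s ∉ B'`**:
`Σ_{w s = 0} [T_0^{(s)}] − [T_1] − (|F_0| − 1)·[T_0] = R(B') + Σ_{s ∈ F_0∖B'} ζ_s`. [folklore] -/
theorem fib_mem_of_rel (hw : ∀ P Q : G, w (P * Q) = w P + w Q) (hk : 1 ≤ k) (hc2 : c * c = 1) (hwc : w c ≠ 0)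
    (L : Submodule ℤ (CMF G c →₀ ℤ)) {B' : Finset G} (hB' : B' ⊆ (univ.filter fun s : G => w s = 0))
    (h3 : Finsupp.single (arcType hw hk hc2 hwc 0) (1 : ℤ) - Finsupp.single (arcType hw hk hc2 hwc 1) 1 + (∑ s ∈ B', (Finsupp.single (oflipCM c hc2 s (arcType hw hk hc2 hwc 0)) (1 : ℤ) - Finsupp.single (arcType hw hk hc2 hwc 0) 1)) - (∑ s ∈ (univ.filter fun s : G => w s = 0) \ B', (Finsupp.single (oflipCM c hc2 s (arcType hw hk hc2 hwc 1)) (1 : ℤ) - Finsupp.single (arcType hw hk hc2 hwc 1) 1)) ∈ L)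
    (hζ : ∀ s ∈ (univ.filter fun s : G => w s = 0) \ B', (Finsupp.single (oflipCM c hc2 s (arcType hw hk hc2 hwc 0)) (1 : ℤ) - Finsupp.single (arcType hw hk hc2 hwc 0) 1) + (Finsupp.single (oflipCM c hc2 s (arcType hw hk hc2 hwc 1)) (1 : ℤ) - Finsupp.single (arcType hw hk hc2 hwc 1) 1) ∈ L) :
    (∑ s ∈ (univ.filter fun s : G => w s = 0), Finsupp.single (oflipCM c hc2 s (arcType hw hk hc2 hwc 0)) (1 : ℤ)) - Finsupp.single (arcType hw hk hc2 hwc 1) (1 : ℤ) -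
      ((((univ.filter fun s : G => w s = 0)).card : ℤ) - 1) • Finsupp.single (arcType hw hk hc2 hwc 0) (1 : ℤ) ∈ L := by
  have h := Submodule.add_mem _ h3 (Submodule.sum_mem _ hζ)
  rw [sum_add_distrib] at h
  rw [← sum_sdiff hB']
  have e : (∑ s ∈ (univ.filter fun s : G => w s = 0) \ B', Finsupp.single (oflipCM c hc2 s (arcType hw hk hc2 hwc 0)) (1 : ℤ)) + (∑ s ∈ B', Finsupp.single (oflipCM c hc2 s (arcType hw hk hc2 hwc 0)) (1 : ℤ)) -
      Finsupp.single (arcType hw hk hc2 hwc 1) (1 : ℤ) - ((((univ.filter fun s : G => w s = 0)).card : ℤ) - 1) • Finsupp.single (arcType hw hk hc2 hwc 0) (1 : ℤ) =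
      Finsupp.single (arcType hw hk hc2 hwc 0) (1 : ℤ) - Finsupp.single (arcType hw hk hc2 hwc 1) 1 + (∑ s ∈ B', (Finsupp.single (oflipCM c hc2 s (arcType hw hk hc2 hwc 0)) (1 : ℤ) - Finsupp.single (arcType hw hk hc2 hwc 0) 1)) - (∑ s ∈ (univ.filter fun s : G => w s = 0) \ B', (Finsupp.single (oflipCM c hc2 s (arcType hw hk hc2 hwc 1)) (1 : ℤ) - Finsupp.single (arcType hw hk hc2 hwc 1) 1)) +
        ((∑ s ∈ (univ.filter fun s : G => w s = 0) \ B', (Finsupp.single (oflipCM c hc2 s (arcType hw hk hc2 hwc 0)) (1 : ℤ) - Finsupp.single (arcType hw hk hc2 hwc 0) 1)) + (∑ s ∈ (univ.filter fun s : G => w s = 0) \ B', (Finsupp.single (oflipCM c hc2 s (arcType hw hk hc2 hwc 1)) (1 : ℤ) - Finsupp.single (arcType hw hk hc2 hwc 1) 1))) := by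
    have hc : ((((univ.filter fun s : G => w s = 0)).card : ℤ)) = ((((univ.filter fun s : G => w s = 0) \ B').card : ℤ)) + ((B'.card : ℤ)) := by
      rw [← Nat.cast_add, card_sdiff_add_card_eq_card hB']
    rw [hc]
    simp only [sum_sub_distrib, sum_const, ← Nat.cast_smul_eq_nsmul ℤ, sub_smul, add_smul, one_smul]
    abel
  rw [e]; exact h

omit [Fintype G] [DecidableEq G] in
/-- `−(w c) = 2` and `1 + 1 = 2` bookkeeping in `ℤ/4` (`k = 2`). [folklore] -/
theorem zero_sub_apply_c_of_two (hw : ∀ P Q : G, w (P * Q) = w P + w Q) (hk : 1 ≤ k) (hk2 : k = 2) (hc2 : c * c = 1) (hwc : w c ≠ 0) :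
    (0 : ZMod (2 ^ k)) - w c = 2 ∧ (1 : ZMod (2 ^ k)) - (-1) = 2 := by
  rw [apply_c hw hk hc2 hwc]
  subst hk2
  refine ⟨by decide, by ring⟩

/-- **THE TOP ARC SHIFT FROM `ζ`**: for `k = 2`, `w t = 0`, `w u = 1` and `ζ_t ∈ ℤ⟨pairs⟩ + ℤ[G]·S`, the arc-shift vector
`[T_0^{(u)}] − [T_0] − [T_1^{(u)}] + [T_1]` lies in `ℤ⟨pairs⟩ + ℤ[G]·S` (it is `pair(T_0^{(u)}) − pair(T_0) − ζ_t·Q`, `w Q = −1`). [folklore] -/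
theorem shift_mem_of_zeta_mem (hw : ∀ P Q : G, w (P * Q) = w P + w Q) (hk : 1 ≤ k) (hk2 : k = 2) (hc2 : c * c = 1)
    (hcen : ∀ x : G, x * c = c * x) (hwc : w c ≠ 0) (S : Finset (CMF G c →₀ ℤ)) {t u : G} (ht : w t = 0) (hu : w u = 1)
    (h : (Finsupp.single (oflipCM c hc2 t (arcType hw hk hc2 hwc 0)) (1 : ℤ) - Finsupp.single (arcType hw hk hc2 hwc 0) 1) + (Finsupp.single (oflipCM c hc2 t (arcType hw hk hc2 hwc 1)) (1 : ℤ) - Finsupp.single (arcType hw hk hc2 hwc 1) 1) ∈ Submodule.span ℤ (pairSet c) ⊔ Submodule.span ℤ (translates c S)) :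
    Finsupp.single (oflipCM c hc2 u (arcType hw hk hc2 hwc 0)) (1 : ℤ) - Finsupp.single (arcType hw hk hc2 hwc 0) 1 -
        Finsupp.single (oflipCM c hc2 u (arcType hw hk hc2 hwc (w u))) 1 + Finsupp.single (arcType hw hk hc2 hwc (w u)) 1 ∈
      Submodule.span ℤ (pairSet c) ⊔ Submodule.span ℤ (translates c S) := by
  obtain ⟨e2, e2'⟩ := zero_sub_apply_c_of_two hw hk hk2 hc2 hwc
  have hQ : w (u⁻¹ * t) = -1 := by rw [hw, map_inv hw, hu, ht, add_zero]
  have eu : t * (u⁻¹ * t)⁻¹ = u := by rw [mul_inv_rev, inv_inv, mul_inv_cancel_left]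
  have h' := mapDomain_rt_mem_psp c hcen (u⁻¹ * t) S h
  simp only [Finsupp.mapDomain_add, Finsupp.mapDomain_sub, Finsupp.mapDomain_single, rt_oflipCM, rt_arcType, hQ, eu, sub_neg_eq_add,
    zero_add, e2'] at h'
  -- the two pairs
  have hcinv : c⁻¹ = c := inv_eq_of_mul_eq_one_right hc2
  have hp1 : pair c (oflipCM c hc2 u (arcType hw hk hc2 hwc 0)) = Finsupp.single (oflipCM c hc2 u (arcType hw hk hc2 hwc 0)) 1 + Finsupp.single (oflipCM c hc2 u (arcType hw hk hc2 hwc 2)) 1 := by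
    rw [pair, rt_oflipCM, rt_arcType, e2, hcinv, hcen, oflipCM_cmul]
  have hp0 : pair c (arcType hw hk hc2 hwc 0) = Finsupp.single (arcType hw hk hc2 hwc 0) 1 + Finsupp.single (arcType hw hk hc2 hwc 2) 1 := by
    rw [pair, rt_arcType, e2]
  have hP1 : pair c (oflipCM c hc2 u (arcType hw hk hc2 hwc 0)) ∈ Submodule.span ℤ (pairSet c) ⊔ Submodule.span ℤ (translates c S) := Submodule.mem_sup_left (Submodule.subset_span (pair_mem_pairSet c _))
  have hP0 : pair c (arcType hw hk hc2 hwc 0) ∈ Submodule.span ℤ (pairSet c) ⊔ Submodule.span ℤ (translates c S) := Submodule.mem_sup_left (Submodule.subset_span (pair_mem_pairSet c _))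
  rw [hp1] at hP1
  rw [hp0] at hP0
  rw [hu]
  have hres := Submodule.sub_mem _ (Submodule.sub_mem _ hP1 hP0) h'
  convert hres using 1
  abel

/-! ## §4 THE ℤ/4-SYLOW LAW -/

/-- **THE ℤ/4-SYLOW LAW: `μ(G, c) = φ₂(G, c)` and `φ₂(G, c) + 1 = β(G, c)`** for every finite `G` with a central involution `c` and an additive
`w : G ↠ ℤ/4` (`k = 2`), `w c ≠ 0`, whose kernel consists of odd-order elements and is non-trivial.  The least number of rank-four face relations whose
base changes generate the integer Hodge lattice modulo the pairs is EXACTLY `β − 1`. [folklore] -/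
theorem isLeast_card_gfaces_generate_of_two [Fintype (CMF G c)] (hw : ∀ P Q : G, w (P * Q) = w P + w Q) (hk : 1 ≤ k) (hk2 : k = 2)
    (hc2 : c * c = 1) (hcen : ∀ x : G, x * c = c * x) (hwc : w c ≠ 0) (h1 : ∃ g₁ : G, w g₁ = 1)
    (hodd : ∀ g : G, w g = 0 → Odd (orderOf g)) {n₀ : G} (hn₀ : w n₀ = 0) (hn₀1 : n₀ ≠ 1) :
    IsLeast {n : ℕ | ∃ S : Finset (CMF G c →₀ ℤ), (↑S ⊆ gfaceSet G c hc2) ∧ S.card = n ∧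
      hodgeSpan c hc2 ≤ Submodule.span ℤ (pairSet c) ⊔ Submodule.span ℤ (translates c S)} (fibreTwo c hc2) ∧
    fibreTwo c hc2 + 1 = Fintype.card (Block c) := by
  have hk' : 2 ≤ k := by omega
  have hβ := fibreTwo_add_one_eq_card_block_of_odd hw hk' h1 hc2 hcen hwc hodd
  refine ⟨?_, hβ⟩
  have hn₀2 : n₀ * n₀ ≠ 1 := mul_self_ne_one_of_odd (hodd n₀ hn₀) hn₀1
  -- the kernel fibre `F_0`, of odd size `2m + 1 ≥ 3`
  obtain ⟨m, hm⟩ := odd_card_ker hw hodd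
  have h3 := three_le_card_ker hw hodd hn₀ hn₀1
  have hm1 : 1 ≤ m := by omega
  -- `B' ⊆ F_0` of size `m`, `b ∈ B'`, `t ≠ t' ∈ F_0 ∖ B'`
  obtain ⟨B', hB'F, hB'c⟩ := exists_subset_card_eq (s := (univ.filter fun s : G => w s = 0)) (n := m) (by omega)
  obtain ⟨b, hb⟩ : B'.Nonempty := by rw [← card_pos]; omega
  have hUc : ((univ.filter fun s : G => w s = 0) \ B').card = m + 1 := by have := card_sdiff_add_card_eq_card hB'F; omega
  obtain ⟨t, ht, t', ht', htt'⟩ := one_lt_card.mp (by omega : 1 < ((univ.filter fun s : G => w s = 0) \ B').card)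
  have ht0 : w t = 0 := (mem_filter.mp (mem_sdiff.mp ht).1).2
  have ht'0 : w t' = 0 := (mem_filter.mp (mem_sdiff.mp ht').1).2
  have htB : t ∉ B' := (mem_sdiff.mp ht).2
  have ht'B : t' ∉ B' := (mem_sdiff.mp ht').2
  have hb0 : w b = 0 := (mem_filter.mp (hB'F hb)).2
  have hsmall : 2 * B'.card < ((univ.filter fun s : G => w s = 0)).card := by omega
  have hlarge : 2 * (((univ.filter fun s : G => w s = 0)).card - B'.card - 1) < ((univ.filter fun s : G => w s = 0)).card := by omega
  -- the two equator types and faces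
  obtain ⟨X₃, hX₃⟩ := exists_sdiff_eq_of_subset_fibre hw hk hc2 hwc B' hB'F
  obtain ⟨X₁, hX₁⟩ := exists_sdiff_eq_of_subset_fibre hw hk hc2 hwc (B'.erase b) ((erase_subset b B').trans hB'F)
  have hwc' : ∀ x : G, w x = 0 → ∀ y : G, w y = 0 → y ≠ c * x := by
    intro x hx y hy h
    apply hwc
    have := congrArg w h
    rw [hw, hx, hy, add_zero] at this
    exact this.symm
  have ht'orb : t' ∉ orb c t := by
    rw [mem_orb]; push Not; exact ⟨htt'.symm, hwc' t ht0 t' ht'0⟩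
  have htorb : t ∉ orb c b := by
    rw [mem_orb]; push Not; exact ⟨fun h => htB (h ▸ hb), hwc' b hb0 t ht0⟩
  have hf₃ : gface c hc2 X₃ t t' ∈ gfaceSet G c hc2 := ⟨X₃, t, t', ht'orb, rfl⟩
  have hf₁ : gface c hc2 X₁ b t ∈ gfaceSet G c hc2 := ⟨X₁, b, t, htorb, rfl⟩
  -- gen 38ʼs cover of the far blocks, with its toward property
  obtain ⟨Sc, hScf, hScc, -, -, -, htwc⟩ := exists_joint_cover_on c (arcType hw hk hc2 hwc 0) hc2
    (fun Bk : Block c => 2 ≤ bpot c (arcType hw hk hc2 hwc 0) Bk.out) (fun _ h => h) ∅ (by rw [Finset.coe_empty]; exact linearIndepOn_empty _ _)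
    (fun f hf => absurd hf (Finset.notMem_empty f))
  set S₀ : Finset (CMF G c →₀ ℤ) := Sc ∪ {gface c hc2 X₁ b t, gface c hc2 X₃ t t'} with hS₀
  have hS₀f : (↑S₀ : Set (CMF G c →₀ ℤ)) ⊆ gfaceSet G c hc2 := by
    intro f hf
    rw [hS₀, coe_union, Set.mem_union] at hf
    rcases hf with hf | hf
    · exact hScf hf
    · rw [coe_insert, coe_singleton, Set.mem_insert_iff, Set.mem_singleton_iff] at hf
      rcases hf with rfl | rfl
      · exact hf₁
      · exact hf₃
  have hScS : Sc ⊆ S₀ := subset_union_left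
  have htw : ∀ Φ : CMF G c, 2 ≤ bpot c (arcType hw hk hc2 hwc 0) Φ → ∃ Q s s' : G, bpot c (arcType hw hk hc2 hwc 0) Φ = ddist (rt c Q (arcType hw hk hc2 hwc 0)) Φ ∧
      s ∈ (rt c Q (arcType hw hk hc2 hwc 0)).1 \ Φ.1 ∧ s' ∈ (rt c Q (arcType hw hk hc2 hwc 0)).1 \ Φ.1 ∧ s ≠ s' ∧
        gface c hc2 Φ s s' ∈ Submodule.span ℤ (pairSet c) ⊔ Submodule.span ℤ (translates c S₀) := by
    intro Φ hΦ
    refine htwc _ ?_ Φ (by rw [bpot_out]; exact hΦ)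
    exact (Submodule.span_mono fun y hy => by obtain ⟨Q, f, hf, e⟩ := hy; exact ⟨Q, f, hScS hf, e⟩).trans le_sup_right
  have hcov := fun Φ => hcov_of_toward c (arcType hw hk hc2 hwc 0) hc2 S₀ htw Φ
  -- the two faces lie in `L = ℤ⟨pairs⟩ + ℤ[G]·S₀`
  have hf₁L : gface c hc2 X₁ b t ∈ Submodule.span ℤ (pairSet c) ⊔ Submodule.span ℤ (translates c S₀) :=
    Submodule.mem_sup_right (mem_span_translates_of_mem c S₀ (by rw [hS₀]; exact mem_union_right _ (mem_insert_self _ _)))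
  have hf₃L : gface c hc2 X₃ t t' ∈ Submodule.span ℤ (pairSet c) ⊔ Submodule.span ℤ (translates c S₀) :=
    Submodule.mem_sup_right (mem_span_translates_of_mem c S₀ (by rw [hS₀]; exact mem_union_right _ (mem_insert_of_mem (mem_singleton_self _))))
  -- the near-zone relations
  have hR3 := rel_of_threeAcross hw hk hc2 hwc h1 _ htw hX₃ hB'F hsmall hlarge ht0 ht'0 htB ht'B htt' hf₃L
  have hR1 := rel_of_oneAcross hw hk hc2 hwc h1 _ htw hb hX₁ hB'F hsmall hlarge ht0 htB hf₁L
  have hζt := zeta_mem_of_rels hw hk hc2 hwc _ ht hR3 hR1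
  have hζ : ∀ s : G, w s = 0 →
      (Finsupp.single (oflipCM c hc2 s (arcType hw hk hc2 hwc 0)) (1 : ℤ) - Finsupp.single (arcType hw hk hc2 hwc 0) 1) +
        (Finsupp.single (oflipCM c hc2 s (arcType hw hk hc2 hwc 1)) (1 : ℤ) - Finsupp.single (arcType hw hk hc2 hwc 1) 1) ∈
          Submodule.span ℤ (pairSet c) ⊔ Submodule.span ℤ (translates c S₀) :=
    fun s hs => zeta_mem_of_zeta_mem hw hk hc2 hcen hwc S₀ ht0 hs hζt
  have hfib := fib_mem_of_rel hw hk hc2 hwc _ hB'F hR3 fun s hs => hζ s (mem_filter.mp (mem_sdiff.mp hs).1).2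
  have hshift : ∀ s ∈ ((arcType hw hk hc2 hwc 0)).1,
      Finsupp.single (oflipCM c hc2 s (arcType hw hk hc2 hwc 0)) (1 : ℤ) - Finsupp.single (arcType hw hk hc2 hwc 0) 1 -
        Finsupp.single (oflipCM c hc2 s (arcType hw hk hc2 hwc (w s))) 1 + Finsupp.single (arcType hw hk hc2 hwc (w s)) 1 ∈
          Submodule.span ℤ (pairSet c) ⊔ Submodule.span ℤ (translates c S₀) := by
    intro s hs
    rcases apply_eq_zero_or_eq_top_of_two hw hk hk2 hc2 hwc hs with h | h
    · rw [shift_eq_zero_of_apply_eq_zero hw hk hc2 hwc h]; exact Submodule.zero_mem _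
    · have h' : w s = 1 := by rw [h]; subst hk2; decide
      exact shift_mem_of_zeta_mem hw hk hk2 hc2 hcen hwc S₀ ht0 h' hζt
  -- the count: `|S₀| ≤ (β − 3) + 2 = φ₂`
  have hnear := three_le_card_filter_bpot_le_one hw hk hk2 hc2 hcen hwc h1 hn₀1 hn₀2 hn₀
  have hsplit := card_filter_add_card_filter_not (s := (univ : Finset (Block c))) (fun Bk : Block c => 2 ≤ bpot c (arcType hw hk hc2 hwc 0) Bk.out)
  have hneg : (univ.filter fun Bk : Block c => ¬ 2 ≤ bpot c (arcType hw hk hc2 hwc 0) Bk.out) = univ.filter fun Bk : Block c => bpot c (arcType hw hk hc2 hwc 0) Bk.out ≤ 1 :=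
    filter_congr fun Bk _ => by omega
  rw [hneg, card_univ] at hsplit
  have hcard : S₀.card ≤ fibreTwo c hc2 := by
    have h2 : ({gface c hc2 X₁ b t, gface c hc2 X₃ t t'} : Finset (CMF G c →₀ ℤ)).card ≤ 2 := card_insert_le _ _
    have hu := card_union_le Sc ({gface c hc2 X₁ b t, gface c hc2 X₃ t t'} : Finset (CMF G c →₀ ℤ))
    rw [← hS₀, hScc] at hu
    omega
  exact (isLeast_card_gfaces_generate_of_shift hw hk hc2 hcen hwc h1 S₀ hS₀f hcard hcov hshift hfib).2

/-- **THE ℤ/4-SYLOW LAW, block form: `μ(G, c) = β(G, c) − 1`.** [folklore] -/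
theorem isLeast_card_gfaces_generate_of_two_card_block [Fintype (CMF G c)] (hw : ∀ P Q : G, w (P * Q) = w P + w Q) (hk : 1 ≤ k)
    (hk2 : k = 2) (hc2 : c * c = 1) (hcen : ∀ x : G, x * c = c * x) (hwc : w c ≠ 0) (h1 : ∃ g₁ : G, w g₁ = 1)
    (hodd : ∀ g : G, w g = 0 → Odd (orderOf g)) {n₀ : G} (hn₀ : w n₀ = 0) (hn₀1 : n₀ ≠ 1) :
    IsLeast {n : ℕ | ∃ S : Finset (CMF G c →₀ ℤ), (↑S ⊆ gfaceSet G c hc2) ∧ S.card = n ∧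
      hodgeSpan c hc2 ≤ Submodule.span ℤ (pairSet c) ⊔ Submodule.span ℤ (translates c S)} (Fintype.card (Block c) - 1) := by
  obtain ⟨h, hβ⟩ := isLeast_card_gfaces_generate_of_two hw hk hk2 hc2 hcen hwc h1 hodd hn₀ hn₀1
  rw [← hβ, Nat.add_sub_cancel]
  exact h

end

end Summit.HodgeConjecture.CorCM.Census.CyclicCharacter
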